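import Summits.HodgeConjecture.HodgeConjecture.Theses.HeckeOrbitCompactness

/-!
# Route HeckeOrbitCompactness — `Assembly` (stmt-HodgeConjecture-14501): exact logical status of the frame

Item stmt-HodgeConjecture-14501 is the frame statement #1 of route HeckeOrbitCompactness,
`Assembly := OrbitDegreeBound → HodgeConjecture` ("it suffices to show X", X = the uniform orbit
degree bound). The route's deciding theorem is `closes (hX) (hG : OrbitGlue) (hS : SummitOffWeilSector)
:= hS (hG hX)` with `OrbitGlue := OrbitDegreeBound → WeilClassesAlgebraic` (crux,
stmt-HodgeConjecture-12682) and `SummitOffWeilSector := WeilClassesAlgebraic → HodgeConjecture`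
(crux ranked last, stmt-HodgeConjecture-14189: the Hodge conjecture off the Weil sector).

This file records, kernel-checked and with no hypothesis beyond the route's declarations and the
summit `Statement`, what the item is and why it can be settled in neither direction short of deciding
the route itself:

* `heckeOrbitCompactness_assembly_of_cruxes` : `OrbitGlue → SummitOffWeilSector → Assembly` (the
  deciding theorem, curried the other way) and `heckeOrbitCompactness_assembly_of_hodgeConjecture` :
  `HC → Assembly`;
* `heckeOrbitCompactness_weilClassesAlgebraic_of_hodgeConjecture` : `HC → WeilClassesAlgebraic` — the
  shared sector target (stmt-HodgeConjecture-2522) is a special case of the summit, because it carries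
  `IsSmoothProjective (2n) A.X` as a hypothesis; hence `HC → OrbitGlue`, `HC → SummitOffWeilSector` and
  `HC ↔ WeilClassesAlgebraic ∧ SummitOffWeilSector`;
* **the exact decomposition** `heckeOrbitCompactness_assembly_iff_orbitGlue_and` :
  `Assembly ↔ OrbitGlue ∧ (OrbitDegreeBound → SummitOffWeilSector)`. In particular
  `heckeOrbitCompactness_orbitGlue_of_assembly : Assembly → OrbitGlue` — the glue crux
  stmt-HodgeConjecture-12682 is NECESSARY for the frame item (a proof of 14501 is a proof of 12682),
  and given the glue the frame is exactly "the Hodge conjecture off the Weil sector, granted X"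
  (`heckeOrbitCompactness_assembly_iff_of_orbitGlue`);
* the truth table: `¬ Assembly ↔ OrbitDegreeBound ∧ ¬ HC` (a refutation proves X AND disproves the
  Clay problem) and `Assembly ↔ OrbitDegreeGrowth ∨ HC` — the frame is exactly "the card's NEG branch
  (stmt-HodgeConjecture-12681, `OrbitDegreeGrowth := ¬ OrbitDegreeBound`) or the summit"; so a proof
  of the route's own refutation crux `OrbitDegreeGrowth` closes this item (and `OrbitGlue`) vacuously
  (`heckeOrbitCompactness_assembly_of_orbitDegreeGrowth`, `heckeOrbitCompactness_orbitGlue_of_orbitDegreeGrowth`):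
  the frame does not discriminate between the line succeeding and X failing;
* granted X: `Assembly ↔ HC` and `OrbitGlue ↔ WeilClassesAlgebraic`.

Nothing here asserts a Theses decl; every statement is an implication between the route's items and
`HodgeConjecture`, a negation, or an equivalence. Prover seat
prover-HodgeConjecture-route-HodgeConjecture-TropicalCuspLift-0, 2026-08-16 (`--supports` 14501).
-/

set_option linter.dupNamespace false

namespace Summit.HodgeConjecture.HodgeConjecture.Theorems

open Summit.HodgeConjecture.HodgeConjecture.Theses

/-- The frame unfolds to `OrbitDegreeBound → HodgeConjecture`. [folklore] -/
theorem heckeOrbitCompactness_assembly_iff :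
    HeckeOrbitCompactness.Assembly ↔
      (HeckeOrbitCompactness.OrbitDegreeBound → _root_.HodgeConjecture) :=
  Iff.rfl

/-- **The two cruxes give the frame**: `OrbitGlue → SummitOffWeilSector → Assembly` — the route's
deciding theorem `closes hX hG hS := hS (hG hX)` with the X-hypothesis moved last. This is the only
intended proof of the item. [folklore] -/
theorem heckeOrbitCompactness_assembly_of_cruxes (hG : HeckeOrbitCompactness.OrbitGlue)
    (hS : HeckeOrbitCompactness.SummitOffWeilSector) : HeckeOrbitCompactness.Assembly :=
  fun hX ↦ HeckeOrbitCompactness.closes hX hG hS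

/-- `HC → Assembly`: the frame is a weakening of the summit. [folklore] -/
theorem heckeOrbitCompactness_assembly_of_hodgeConjecture :
    _root_.HodgeConjecture → HeckeOrbitCompactness.Assembly :=
  fun hHC _ ↦ hHC

/-- A kill of the frame is a disproof of the Hodge conjecture (contrapositive of
`heckeOrbitCompactness_assembly_of_hodgeConjecture`). [folklore] -/
theorem heckeOrbitCompactness_not_hodgeConjecture_of_not_assembly
    (h : ¬ HeckeOrbitCompactness.Assembly) : ¬ _root_.HodgeConjecture :=
  fun hHC ↦ h (heckeOrbitCompactness_assembly_of_hodgeConjecture hHC)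

/-- **The sector target is a special case of the summit**: `HC → WeilClassesAlgebraic`
(stmt-HodgeConjecture-2522 as spelled by this route), because the target carries the hypothesis
`IsSmoothProjective (2n) A.X`, under which `HodgeConjecture` applies to `A.X` verbatim and its cycle
part in codimension `n` is the claim; none of the Weil-type hypotheses (`φ ≫ φ = -d`, the
eigen-decomposition `c = c₁ + c₂`) is used. [folklore] -/
theorem heckeOrbitCompactness_weilClassesAlgebraic_of_hodgeConjecture :
    _root_.HodgeConjecture → HeckeOrbitCompactness.WeilClassesAlgebraic := by
  intro hHC n _ d _ A φ _ hsp _ c hrat hhodge _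
  exact (hHC hsp).2 n c hrat hhodge

/-- `HC → SummitOffWeilSector` (the last crux is `_ → HodgeConjecture`). [folklore] -/
theorem heckeOrbitCompactness_summitOffWeilSector_of_hodgeConjecture :
    _root_.HodgeConjecture → HeckeOrbitCompactness.SummitOffWeilSector :=
  fun hHC _ ↦ hHC

/-- `HC → OrbitGlue` (the glue crux is `_ → WeilClassesAlgebraic`, a special case of `HC`).
[folklore] -/
theorem heckeOrbitCompactness_orbitGlue_of_hodgeConjecture :
    _root_.HodgeConjecture → HeckeOrbitCompactness.OrbitGlue :=
  fun hHC _ ↦ heckeOrbitCompactness_weilClassesAlgebraic_of_hodgeConjecture hHC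

/-- Bookkeeping identity of the last crux: `HC ↔ WeilClassesAlgebraic ∧ SummitOffWeilSector` — the
Weil sector and its declared complement make up the summit exactly. [folklore] -/
theorem heckeOrbitCompactness_hodgeConjecture_iff_weil_and_offWeil :
    _root_.HodgeConjecture ↔
      HeckeOrbitCompactness.WeilClassesAlgebraic ∧ HeckeOrbitCompactness.SummitOffWeilSector :=
  ⟨fun hHC ↦ ⟨heckeOrbitCompactness_weilClassesAlgebraic_of_hodgeConjecture hHC, fun _ ↦ hHC⟩,
    fun h ↦ h.2 h.1⟩

/-- **Exact decomposition of the frame over the route's cruxes**: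
`Assembly ↔ OrbitGlue ∧ (OrbitDegreeBound → SummitOffWeilSector)`. Forwards: from `X → HC` one
gets `X → WeilClassesAlgebraic` (the sector is a special case of `HC`) and, trivially,
`X → (WeilClassesAlgebraic → HC)`; backwards: modus ponens twice. So the item is the conjunction of
the glue crux (stmt-HodgeConjecture-12682) and of "the Hodge conjecture off the Weil sector, granted
X" — a weakening of the last crux stmt-HodgeConjecture-14189 by exactly the hypothesis X.
[folklore] -/
theorem heckeOrbitCompactness_assembly_iff_orbitGlue_and :
    HeckeOrbitCompactness.Assembly ↔
      HeckeOrbitCompactness.OrbitGlue ∧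
        (HeckeOrbitCompactness.OrbitDegreeBound → HeckeOrbitCompactness.SummitOffWeilSector) :=
  ⟨fun hA ↦
      ⟨fun hX ↦ heckeOrbitCompactness_weilClassesAlgebraic_of_hodgeConjecture (hA hX),
        fun hX _ ↦ hA hX⟩,
    fun h hX ↦ h.2 hX (h.1 hX)⟩

/-- **The glue crux is necessary for the frame**: `Assembly → OrbitGlue` — any proof of
stmt-HodgeConjecture-14501 is a proof of stmt-HodgeConjecture-12682. [folklore] -/
theorem heckeOrbitCompactness_orbitGlue_of_assembly (hA : HeckeOrbitCompactness.Assembly) :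
    HeckeOrbitCompactness.OrbitGlue :=
  (heckeOrbitCompactness_assembly_iff_orbitGlue_and.1 hA).1

/-- Granted the glue crux, the frame IS "the Hodge conjecture off the Weil sector, granted X":
`OrbitGlue → (Assembly ↔ (OrbitDegreeBound → SummitOffWeilSector))`. [folklore] -/
theorem heckeOrbitCompactness_assembly_iff_of_orbitGlue (hG : HeckeOrbitCompactness.OrbitGlue) :
    HeckeOrbitCompactness.Assembly ↔
      (HeckeOrbitCompactness.OrbitDegreeBound → HeckeOrbitCompactness.SummitOffWeilSector) :=
  ⟨fun hA ↦ (heckeOrbitCompactness_assembly_iff_orbitGlue_and.1 hA).2,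
    fun h ↦ heckeOrbitCompactness_assembly_iff_orbitGlue_and.2 ⟨hG, h⟩⟩

/-- Granted X, the frame IS the summit: `OrbitDegreeBound → (Assembly ↔ HC)`. [folklore] -/
theorem heckeOrbitCompactness_assembly_iff_hodgeConjecture
    (hX : HeckeOrbitCompactness.OrbitDegreeBound) :
    HeckeOrbitCompactness.Assembly ↔ _root_.HodgeConjecture :=
  ⟨fun hA ↦ hA hX, fun hHC _ ↦ hHC⟩

/-- Granted X, the glue crux IS the sector target: `OrbitDegreeBound → (OrbitGlue ↔
WeilClassesAlgebraic)`. [folklore] -/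
theorem heckeOrbitCompactness_orbitGlue_iff_weilClassesAlgebraic
    (hX : HeckeOrbitCompactness.OrbitDegreeBound) :
    HeckeOrbitCompactness.OrbitGlue ↔ HeckeOrbitCompactness.WeilClassesAlgebraic :=
  ⟨fun hG ↦ hG hX, fun hW _ ↦ hW⟩

/-- **The exact content of a refutation of the frame**: `¬ Assembly ↔ OrbitDegreeBound ∧ ¬ HC`
(classical `¬ (P → Q) ↔ P ∧ ¬ Q`): a refutation proves the uniform orbit bound X AND disproves the
Hodge conjecture. [folklore] -/
theorem heckeOrbitCompactness_not_assembly_iff :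
    ¬ HeckeOrbitCompactness.Assembly ↔
      HeckeOrbitCompactness.OrbitDegreeBound ∧ ¬ _root_.HodgeConjecture :=
  Classical.not_imp

/-- **Truth table of the frame**: `Assembly ↔ OrbitDegreeGrowth ∨ HC`, where
`OrbitDegreeGrowth := ¬ OrbitDegreeBound` is the route's own ranked refutation crux
(stmt-HodgeConjecture-12681): the item is exactly "the card's NEG branch or the summit".
[folklore] -/
theorem heckeOrbitCompactness_assembly_iff_growth_or :
    HeckeOrbitCompactness.Assembly ↔
      HeckeOrbitCompactness.OrbitDegreeGrowth ∨ _root_.HodgeConjecture :=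
  imp_iff_not_or

/-- The NEG crux closes the frame vacuously: `OrbitDegreeGrowth → Assembly` — so a `proved` on this
item does not discriminate between the line succeeding (X ∧ glue ∧ complement) and X failing.
[folklore] -/
theorem heckeOrbitCompactness_assembly_of_orbitDegreeGrowth
    (h : HeckeOrbitCompactness.OrbitDegreeGrowth) : HeckeOrbitCompactness.Assembly :=
  fun hX ↦ absurd hX h

/-- Likewise the NEG crux closes the glue crux vacuously: `OrbitDegreeGrowth → OrbitGlue`.
[folklore] -/
theorem heckeOrbitCompactness_orbitGlue_of_orbitDegreeGrowth
    (h : HeckeOrbitCompactness.OrbitDegreeGrowth) : HeckeOrbitCompactness.OrbitGlue :=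
  fun hX ↦ absurd hX h

/-- Summary in one line: the frame holds iff X fails, or the glue holds together with the Hodge
conjecture off the Weil sector: `Assembly ↔ OrbitDegreeGrowth ∨ (OrbitGlue ∧ SummitOffWeilSector)`.
[folklore] -/
theorem heckeOrbitCompactness_assembly_iff_growth_or_cruxes :
    HeckeOrbitCompactness.Assembly ↔
      HeckeOrbitCompactness.OrbitDegreeGrowth ∨
        (HeckeOrbitCompactness.OrbitGlue ∧ HeckeOrbitCompactness.SummitOffWeilSector) := by
  constructor
  · intro hA
    by_cases hX : HeckeOrbitCompactness.OrbitDegreeBound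
    · exact Or.inr ⟨heckeOrbitCompactness_orbitGlue_of_assembly hA,
        heckeOrbitCompactness_summitOffWeilSector_of_hodgeConjecture (hA hX)⟩
    · exact Or.inl hX
  · rintro (h | ⟨hG, hS⟩)
    · exact heckeOrbitCompactness_assembly_of_orbitDegreeGrowth h
    · exact heckeOrbitCompactness_assembly_of_cruxes hG hS

end Summit.HodgeConjecture.HodgeConjecture.Theorems
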